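import Literature.RepresentationTheory.AlgebraicGroups.SL2SymPower
import Mathlib.LinearAlgebra.Vandermonde
import Mathlib.LinearAlgebra.Matrix.NonsingularInverse
import Mathlib.Algebra.CharP.Lemmas
import HarnessLib

/-!
# Irreducibility of `Sym^m` of the standard representation of `SL₂` in characteristic `> m`

The classical fact (Brauer–Nesbitt): for a field `k` in which `1, 2, …, m` are invertible
(characteristic `0` or `> m`), the symmetric power `Sym^m (k²)` of the standard representation
of `SL₂` — realised in `Literature.RepresentationTheory.AlgebraicGroups.SL2SymPower` as the
matrices `symPowerMat m g` acting on `k^{m+1}` (binary forms of degree `m` in the monomial basis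
`X₀^{m-i} X₁^i`) — has no invariant subspace other than `0` and `k^{m+1}` under the two elementary
unipotents `u(1) = !![1, 1; 0, 1]` and `v(1) = !![1, 0; 1, 1]`; these generate the image of
`SL₂(ℤ)`, which in characteristic `p` is `SL₂(𝔽_p)`.  In particular *"the `m`th symmetric power of
the standard representation of `SL₂(𝔽_t)` is irreducible whenever `t > m`"* — the sentence with
which Newton–Thorne verify the irreducibility hypothesis of [BLGGT14, Thm. 4.2.1] in the proof of
Prop. 3.9 of *Symmetric power functoriality, II* (p. 25 of arXiv:2009.07180), and the standing
large-image hypothesis on `Symⁿ⁻¹ r̄_{π,ι}` in their automorphy lifting theorem (Thm. 2.1).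

## The proof formalized

* `symPowerMat_upper_one_mulVec`: `(Sym^m(u(1)) w)_i = ∑_{j ≥ i} C(j, i) w_j`
  (from `symPowerMat_upper`).
* `single_zero_mem_of_stable_upper` (**lowering to the highest weight line**): if `W` is stable
  under `Sym^m(u(1))` and contains `w ≠ 0` with last non-zero coordinate `w_{j₀}`, then
  `w' = Sym^m(u(1)) w − w ∈ W` has last non-zero coordinate `j₀ · w_{j₀}` in position `j₀ − 1`;
  inducting, `e₀ = X₀^m ∈ W` (this uses `1, …, m ≠ 0` in `k`).
* `symPowerMat_lower_mulVec_single_zero`: `Sym^m(v(x)) e₀ = (C(m, i) xⁱ)_i`, i.e.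
  `v(x) · X₀^m = (X₀ + x X₁)^m`; with `v(1)ⁿ = v(n)` (`lower_one_pow`, `symPowerMat_pow`) the
  vectors `(C(m, i) nⁱ)_i`, `n = 0, …, m`, lie in `W`; they are the rows of
  `vandermonde (0, 1, …, m) · diag (C(m, i))`, of non-zero determinant
  (`Matrix.det_vandermonde_ne_zero_iff`; the nodes `0, …, m` are distinct in `k` and
  `C(m, i) ∣ m!` is non-zero in `k`), so they span `k^{m+1}` (`Matrix.vecMul_surjective_iff_isUnit`).
* `eq_bot_or_eq_top_of_stable_unipotent`: the theorem; corollaries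
  `eq_bot_or_eq_top_of_stable_subgroup` (any subgroup `H ≤ SL₂(k)` containing `u(1), v(1)`, through
  `symPowerGL m`, characteristic `p > m`) and `eq_bot_or_eq_top_of_stable_unipotent_charZero`.

Mathlib has the standard representation and `Matrix.vandermonde`, but no symmetric power
representation of `SL₂` (see the companion file) and hence no form of this irreducibility.

## References

* R. Brauer, C. Nesbitt, *On the modular characters of groups*, Ann. of Math. 42 (1941), §30
  (the irreducible `SL₂(𝔽_p)`-modules `Sym^a`, `0 ≤ a ≤ p − 1`). [folklore]
* J. Newton, J. A. Thorne, *Symmetric power functoriality for holomorphic modular forms, II*,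
  Publ. Math. IHÉS 134 (2021), proof of Prop. 3.9 (arXiv:2009.07180, p. 25) [NewtonThorneIHES2021b].
-/

noncomputable section

open Matrix

namespace Literature.RepresentationTheory.AlgebraicGroups.SL2Sym

variable {k : Type*} [Field k] {m : ℕ}

/-! ### Arithmetic input: `1, …, m` invertible in `k` -/

/-- If `1, …, m` are non-zero in `k` then so is `m!`. [folklore] -/
lemma factorial_cast_ne_zero (hchar : ∀ n : ℕ, 0 < n → n ≤ m → (n : k) ≠ 0) :
    ((m.factorial : ℕ) : k) ≠ 0 := by
  rw [← Finset.prod_range_add_one_eq_factorial, Nat.cast_prod, Finset.prod_ne_zero_iff]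
  intro n hn
  exact hchar (n + 1) (Nat.succ_pos n) (Finset.mem_range.mp hn)

/-- If `1, …, m` are non-zero in `k` then so is every `C(m, i)`, `i ≤ m` (a divisor of `m!`).
[folklore] -/
lemma choose_cast_ne_zero (hchar : ∀ n : ℕ, 0 < n → n ≤ m → (n : k) ≠ 0) {i : ℕ} (hi : i ≤ m) :
    ((m.choose i : ℕ) : k) ≠ 0 := by
  intro h0
  apply factorial_cast_ne_zero hchar
  rw [← Nat.choose_mul_factorial_mul_factorial hi, Nat.cast_mul, Nat.cast_mul, h0, zero_mul,
    zero_mul]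

/-- If `1, …, m` are non-zero in `k` then `0, 1, …, m` are distinct in `k`. [folklore] -/
lemma natCast_fin_injective (hchar : ∀ n : ℕ, 0 < n → n ≤ m → (n : k) ≠ 0) :
    Function.Injective fun a : Fin (m + 1) => ((a : ℕ) : k) := by
  intro a b hab
  simp only at hab
  apply Fin.ext
  by_contra hne
  rcases Nat.lt_or_gt_of_ne hne with h | h
  · apply hchar (b - a) (by omega) (by have := b.2; omega)
    rw [Nat.cast_sub h.le, hab, sub_self]
  · apply hchar (a - b) (by omega) (by have := a.2; omega)
    rw [Nat.cast_sub h.le, hab, sub_self]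

/-- In characteristic `p > m`, the integers `1, …, m` are non-zero in `k`. [folklore] -/
lemma natCast_ne_zero_of_lt_char (p : ℕ) [CharP k p] (hm : m < p) :
    ∀ n : ℕ, 0 < n → n ≤ m → (n : k) ≠ 0 := by
  intro n hn hnm h0
  rw [CharP.cast_eq_zero_iff k p n] at h0
  exact Nat.not_dvd_of_pos_of_lt hn (by omega) h0

/-! ### The upper unipotent `u(1)` lowers the last non-zero coordinate -/

/-- Coordinates of `Sym^m(u(1)) w`: `(Sym^m(u(1)) w)_i = ∑_{j ≥ i} C(j, i) w_j`. [folklore] -/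
lemma symPowerMat_upper_one_mulVec (w : Fin (m + 1) → k) (i : Fin (m + 1)) :
    (symPowerMat m !![1, 1; 0, 1] *ᵥ w) i =
      ∑ j : Fin (m + 1), (if (i : ℕ) ≤ j then (((j : ℕ).choose i : ℕ) : k) else 0) * w j := by
  simp only [Matrix.mulVec, dotProduct, symPowerMat_upper, one_pow, mul_one]

/-- **Lowering to the highest-weight line.**  Let `W ⊆ k^{m+1}` be stable under `Sym^m(u(1))`,
`u(1) = !![1, 1; 0, 1]`, and suppose `1, …, m` are non-zero in `k`.  If `W` contains a vector `w`
whose last non-zero coordinate is `w_{j₀}` (`(j₀ : ℕ) = t`), then `e₀ = (1, 0, …, 0)` (the binary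
form `X₀^m`) lies in `W`: the vector `Sym^m(u(1)) w − w ∈ W` has last non-zero coordinate
`j₀ · w_{j₀}` in position `j₀ − 1`, and one inducts on `j₀`. [folklore] -/
theorem single_zero_mem_of_stable_upper (hchar : ∀ n : ℕ, 0 < n → n ≤ m → (n : k) ≠ 0)
    (W : Submodule k (Fin (m + 1) → k))
    (hU : ∀ w ∈ W, symPowerMat m !![1, 1; 0, 1] *ᵥ w ∈ W) :
    ∀ (t : ℕ) (j₀ : Fin (m + 1)), (j₀ : ℕ) = t → ∀ w ∈ W,
      (∀ j : Fin (m + 1), (j₀ : ℕ) < j → w j = 0) → w j₀ ≠ 0 →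
        Pi.single (0 : Fin (m + 1)) (1 : k) ∈ W := by
  intro t
  induction t with
  | zero =>
    intro j₀ hj₀ w hw hzero hne
    have hj : j₀ = 0 := Fin.ext hj₀
    subst hj
    have key : Pi.single (0 : Fin (m + 1)) (1 : k) = (w 0)⁻¹ • w := by
      funext j
      by_cases h : j = 0
      · subst h
        simp [inv_mul_cancel₀ hne]
      · rw [Pi.smul_apply, Pi.single_eq_of_ne h,
          hzero j (Nat.pos_of_ne_zero fun h' => h (Fin.ext h')), smul_zero]
    rw [key]
    exact W.smul_mem _ hw
  | succ t ih =>
    intro j₀ hj₀ w hw hzero hne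
    have ht : t < m + 1 := by have := j₀.2; omega
    set j₁ : Fin (m + 1) := ⟨t, ht⟩ with hj₁
    set w' : Fin (m + 1) → k := symPowerMat m !![1, 1; 0, 1] *ᵥ w - w with hw'
    have hw'W : w' ∈ W := W.sub_mem (hU w hw) hw
    refine ih j₁ rfl w' hw'W ?_ ?_
    · -- the coordinates of `w'` beyond `t` vanish
      intro j hj
      change t < (j : ℕ) at hj
      rw [hw', Pi.sub_apply, symPowerMat_upper_one_mulVec, Finset.sum_eq_single j,
        if_pos le_rfl, Nat.choose_self, Nat.cast_one, one_mul, sub_self]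
      · intro l _ hl
        by_cases hjl : (j : ℕ) ≤ l
        · have hlt : (j₀ : ℕ) < l := by
            have : (j : ℕ) ≠ l := fun h => hl (Fin.ext h).symm
            omega
          rw [if_pos hjl, hzero l hlt, mul_zero]
        · rw [if_neg hjl, zero_mul]
      · intro h
        exact absurd (Finset.mem_univ j) h
    · -- the coordinate `t` of `w'` is `(t + 1) w_{j₀} ≠ 0`
      have hne01 : j₁ ≠ j₀ := fun h => by
        have := congrArg Fin.val h
        change t = (j₀ : ℕ) at this
        omega
      have hval : w' j₁ = (((t + 1 : ℕ) : ℕ) : k) * w j₀ := by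
        rw [hw', Pi.sub_apply, symPowerMat_upper_one_mulVec, Fintype.sum_eq_add j₁ j₀ hne01]
        · have h1 : ((j₁ : ℕ) ≤ j₁) := le_rfl
          have h2 : ((j₁ : ℕ) ≤ j₀) := by change t ≤ (j₀ : ℕ); omega
          rw [if_pos h1, if_pos h2, Nat.choose_self, Nat.cast_one, one_mul]
          have h3 : (j₀ : ℕ).choose j₁ = t + 1 := by
            change (j₀ : ℕ).choose t = t + 1
            rw [hj₀, Nat.choose_succ_self_right]
          rw [h3]
          ring
        · rintro l ⟨hl₁, hl₀⟩
          by_cases h1 : (j₁ : ℕ) ≤ l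
          · have hlt : (j₀ : ℕ) < l := by
              have h2 : (l : ℕ) ≠ t := fun h => hl₁ (Fin.ext h)
              have h3 : (l : ℕ) ≠ (j₀ : ℕ) := fun h => hl₀ (Fin.ext h)
              change t ≤ (l : ℕ) at h1
              omega
            rw [if_pos h1, hzero l hlt, mul_zero]
          · rw [if_neg h1, zero_mul]
      rw [hval]
      exact mul_ne_zero (hchar (t + 1) (Nat.succ_pos t) (by have := j₀.2; omega)) hne

/-- **`X₀^m` lies in every non-zero `u(1)`-stable subspace** (when `1, …, m ≠ 0` in `k`).
[folklore] -/
theorem single_zero_mem_of_ne_bot (hchar : ∀ n : ℕ, 0 < n → n ≤ m → (n : k) ≠ 0)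
    (W : Submodule k (Fin (m + 1) → k))
    (hU : ∀ w ∈ W, symPowerMat m !![1, 1; 0, 1] *ᵥ w ∈ W) (hW : W ≠ ⊥) :
    Pi.single (0 : Fin (m + 1)) (1 : k) ∈ W := by
  obtain ⟨w, hw, hw0⟩ := (Submodule.ne_bot_iff W).mp hW
  classical
  have hS : (Finset.univ.filter fun j : Fin (m + 1) => w j ≠ 0).Nonempty := by
    by_contra h
    apply hw0
    funext j
    by_contra hj
    exact h ⟨j, by simpa using hj⟩
  set j₀ := (Finset.univ.filter fun j : Fin (m + 1) => w j ≠ 0).max' hS with hj₀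
  have hmem : j₀ ∈ Finset.univ.filter fun j : Fin (m + 1) => w j ≠ 0 := Finset.max'_mem _ hS
  have hj₀ne : w j₀ ≠ 0 := by simpa using hmem
  have hzero : ∀ j : Fin (m + 1), (j₀ : ℕ) < j → w j = 0 := by
    intro j hj
    by_contra h
    have hle : j ≤ j₀ := Finset.le_max' _ j (by simpa using h)
    exact absurd hj (not_lt.mpr hle)
  exact single_zero_mem_of_stable_upper hchar W hU j₀ j₀ rfl w hw hzero hj₀ne

/-! ### The lower unipotents `v(x)` generate everything from `X₀^m` -/

/-- `v(1)ⁿ = v(n)`: `!![1, 0; 1, 1] ^ n = !![1, 0; n, 1]`. [folklore] -/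
lemma lower_one_pow (n : ℕ) :
    (!![1, 0; 1, 1] : Matrix (Fin 2) (Fin 2) k) ^ n = !![1, 0; (n : k), 1] := by
  induction n with
  | zero => rw [pow_zero, Nat.cast_zero, Matrix.one_fin_two]
  | succ n ih =>
    rw [pow_succ, ih, Matrix.mul_fin_two]
    simp

/-- `Sym^m (gⁿ) = (Sym^m g)ⁿ`. [folklore] -/
lemma symPowerMat_pow (g : Matrix (Fin 2) (Fin 2) k) (n : ℕ) :
    symPowerMat m (g ^ n) = symPowerMat m g ^ n :=
  map_pow (symPowerMonoidHom m) g n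

/-- `Sym^m(v(x)) e₀ = (C(m, i) xⁱ)_i` — column `0` of `symPowerMat_lower`, i.e.
`v(x) · X₀^m = (X₀ + x X₁)^m`. [folklore] -/
lemma symPowerMat_lower_mulVec_single_zero (x : k) :
    symPowerMat m !![1, 0; x, 1] *ᵥ Pi.single (0 : Fin (m + 1)) (1 : k) =
      fun i : Fin (m + 1) => ((m.choose i : ℕ) : k) * x ^ (i : ℕ) := by
  rw [Matrix.mulVec_single_one]
  funext i
  rw [Matrix.col_apply, symPowerMat_lower]
  simp

/-- Stability under a matrix gives stability under its powers. [folklore] -/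
lemma pow_mulVec_mem {ι : Type*} [Fintype ι] [DecidableEq ι] (A : Matrix ι ι k)
    (W : Submodule k (ι → k)) (hA : ∀ w ∈ W, A *ᵥ w ∈ W) (n : ℕ) :
    ∀ w ∈ W, (A ^ n) *ᵥ w ∈ W := by
  induction n with
  | zero => intro w hw; simpa using hw
  | succ n ih =>
    intro w hw
    rw [pow_succ, ← Matrix.mulVec_mulVec]
    exact ih _ (hA w hw)

/-- The matrix with rows `Sym^m(v(n)) e₀ = (C(m, i) nⁱ)_i`, `n = 0, …, m`: a Vandermonde matrix
times `diag (C(m, i))`. [folklore] -/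
def binomialVandermonde (k : Type*) [Field k] (m : ℕ) : Matrix (Fin (m + 1)) (Fin (m + 1)) k :=
  Matrix.of fun a i => ((m.choose i : ℕ) : k) * ((a : ℕ) : k) ^ (i : ℕ)

/-- `binomialVandermonde = vandermonde (0, 1, …, m) * diagonal (C(m, ·))`. [folklore] -/
lemma binomialVandermonde_eq (k : Type*) [Field k] (m : ℕ) :
    binomialVandermonde k m =
      Matrix.vandermonde (fun a : Fin (m + 1) => ((a : ℕ) : k)) *
        Matrix.diagonal fun i : Fin (m + 1) => ((m.choose i : ℕ) : k) := by
  ext a i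
  rw [Matrix.mul_diagonal, Matrix.vandermonde_apply, binomialVandermonde, Matrix.of_apply, mul_comm]

/-- `det (binomialVandermonde) ≠ 0` when `1, …, m` are non-zero in `k`. [folklore] -/
lemma det_binomialVandermonde_ne_zero (hchar : ∀ n : ℕ, 0 < n → n ≤ m → (n : k) ≠ 0) :
    (binomialVandermonde k m).det ≠ 0 := by
  rw [binomialVandermonde_eq, Matrix.det_mul, Matrix.det_diagonal]
  refine mul_ne_zero (Matrix.det_vandermonde_ne_zero_iff.mpr (natCast_fin_injective hchar)) ?_
  rw [Finset.prod_ne_zero_iff]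
  intro i _
  exact choose_cast_ne_zero hchar (Nat.le_of_lt_succ i.2)

/-! ### The theorem -/

/-- **Irreducibility of `Sym^m` of the standard representation of `SL₂` under the elementary
unipotents, characteristic `0` or `> m`.**  Let `k` be a field in which `1, …, m` are non-zero,
and let `W ⊆ k^{m+1}` be a subspace stable under `Sym^m(u(1))` and `Sym^m(v(1))`
(`u(1) = !![1, 1; 0, 1]`, `v(1) = !![1, 0; 1, 1]`, `Sym^m = symPowerMat m`, the action on binary
forms of degree `m`).  Then `W = 0` or `W = k^{m+1}`. [folklore] -/
theorem eq_bot_or_eq_top_of_stable_unipotent (hchar : ∀ n : ℕ, 0 < n → n ≤ m → (n : k) ≠ 0)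
    (W : Submodule k (Fin (m + 1) → k))
    (hU : ∀ w ∈ W, symPowerMat m !![1, 1; 0, 1] *ᵥ w ∈ W)
    (hV : ∀ w ∈ W, symPowerMat m !![1, 0; 1, 1] *ᵥ w ∈ W) : W = ⊥ ∨ W = ⊤ := by
  classical
  rcases eq_or_ne W ⊥ with h | hne
  · exact Or.inl h
  right
  have he₀ : Pi.single (0 : Fin (m + 1)) (1 : k) ∈ W := single_zero_mem_of_ne_bot hchar W hU hne
  -- the rows `(C(m, i) nⁱ)_i` lie in `W`
  have hrow : ∀ n : ℕ, (fun i : Fin (m + 1) => ((m.choose i : ℕ) : k) * (n : k) ^ (i : ℕ)) ∈ W := by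
    intro n
    have h := pow_mulVec_mem (symPowerMat m !![1, 0; 1, 1]) W hV n _ he₀
    rwa [← symPowerMat_pow, lower_one_pow, symPowerMat_lower_mulVec_single_zero] at h
  -- they span everything
  rw [Submodule.eq_top_iff']
  intro y
  have hunit : IsUnit (binomialVandermonde k m) :=
    (Matrix.isUnit_iff_isUnit_det _).mpr (isUnit_iff_ne_zero.mpr
      (det_binomialVandermonde_ne_zero hchar))
  obtain ⟨v, rfl⟩ := (Matrix.vecMul_surjective_iff_isUnit.mpr hunit) y
  change v ᵥ* binomialVandermonde k m ∈ W
  rw [Matrix.vecMul_eq_sum]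
  exact W.sum_mem fun a _ => W.smul_mem _ (hrow a)

/-- The same in characteristic `0`. [folklore] -/
theorem eq_bot_or_eq_top_of_stable_unipotent_charZero [CharZero k]
    (W : Submodule k (Fin (m + 1) → k))
    (hU : ∀ w ∈ W, symPowerMat m !![1, 1; 0, 1] *ᵥ w ∈ W)
    (hV : ∀ w ∈ W, symPowerMat m !![1, 0; 1, 1] *ᵥ w ∈ W) : W = ⊥ ∨ W = ⊤ :=
  eq_bot_or_eq_top_of_stable_unipotent (fun _ hn _ => Nat.cast_ne_zero.mpr hn.ne') W hU hV

/-- The elementary unipotent `u(1) = !![1, 1; 0, 1] ∈ SL₂(k)`. [folklore] -/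
def upperOne (k : Type*) [Field k] : Matrix.SpecialLinearGroup (Fin 2) k :=
  ⟨!![1, 1; 0, 1], by simp [Matrix.det_fin_two_of]⟩

/-- The elementary unipotent `v(1) = !![1, 0; 1, 1] ∈ SL₂(k)`. [folklore] -/
def lowerOne (k : Type*) [Field k] : Matrix.SpecialLinearGroup (Fin 2) k :=
  ⟨!![1, 0; 1, 1], by simp [Matrix.det_fin_two_of]⟩

/-- `↑(upperOne k) = !![1, 1; 0, 1]`. [folklore] -/
@[simp] lemma coe_upperOne (k : Type*) [Field k] :
    ((upperOne k : Matrix.SpecialLinearGroup (Fin 2) k) : Matrix (Fin 2) (Fin 2) k) =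
      !![1, 1; 0, 1] := rfl

/-- `↑(lowerOne k) = !![1, 0; 1, 1]`. [folklore] -/
@[simp] lemma coe_lowerOne (k : Type*) [Field k] :
    ((lowerOne k : Matrix.SpecialLinearGroup (Fin 2) k) : Matrix (Fin 2) (Fin 2) k) =
      !![1, 0; 1, 1] := rfl

/-- **"The `m`th symmetric power of the standard representation of `SL₂(𝔽_p)` is irreducible
whenever `p > m`"** (Newton–Thorne II, proof of Prop. 3.9, p. 25; Brauer–Nesbitt).  Formally:
`k` a field of characteristic `p > m`, `H` any subgroup of `SL₂(k)` containing the elementary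
unipotents `u(1)`, `v(1)` — e.g. the image of `SL₂(𝔽_p)`, which they generate — and
`W ⊆ k^{m+1}` a subspace stable under `Sym^m(h)` (`symPowerGL m h`) for all `h ∈ H`; then
`W = 0` or `W = k^{m+1}` (absolute irreducibility, `k` being arbitrary of characteristic `p`).
[cite: NewtonThorneIHES2021b, proof of Prop. 3.9 (p. 25 of arXiv:2009.07180)] -/
theorem eq_bot_or_eq_top_of_stable_subgroup (p : ℕ) [CharP k p] (hm : m < p)
    (H : Subgroup (Matrix.SpecialLinearGroup (Fin 2) k)) (hu : upperOne k ∈ H)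
    (hv : lowerOne k ∈ H) (W : Submodule k (Fin (m + 1) → k))
    (hW : ∀ h ∈ H, ∀ w ∈ W,
      ((symPowerGL m h : GL (Fin (m + 1)) k) : Matrix (Fin (m + 1)) (Fin (m + 1)) k) *ᵥ w ∈ W) :
    W = ⊥ ∨ W = ⊤ :=
  eq_bot_or_eq_top_of_stable_unipotent (natCast_ne_zero_of_lt_char p hm) W
    (fun w hw => by simpa using hW _ hu w hw) (fun w hw => by simpa using hW _ hv w hw)

end Literature.RepresentationTheory.AlgebraicGroups.SL2Sym
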